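import Literature.NumberTheory.Automorphic.JacquetRayShellTrace                       -- ★ p848022 R2d «CASS-SHELL» `Representation.smoothTrace_indicator_shell_eq`
import Literature.NumberTheory.Automorphic.JacquetRayLevelDepth                       -- ★ p848448 «LEVEL-DEPTH» `Representation.exists_nhds_forall_range_fixedPointsMk_eq_top`
import Literature.NumberTheory.Automorphic.SmoothTraceBoxChar                         -- ★ p842000 `smoothTrace_twist_comp_fst` (`Tr (ρ ⊠ χ) = Tr ρ` of the `χ`-average)
import Literature.NumberTheory.Rogawski1990.LocalTransferFundamentalLemma             -- ★ `IsLocSmooth`, `isLocSmooth_indicator`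
import Literature.NumberTheory.Rogawski1990.LocalAPacket                              -- ★ `charDist`
import HarnessLib

/-!
# F0 · P3c · line LH6 «StCharTS» — ROAD (D) «DEEP-FL», SLICE (D-b) «CASS-H-TRACE», KIT (generic): product shells, dominance of `z · aᵐ`,
# coset averages of characters, and the character of `ρ ⊠ χ` on a product shell `(K_n b K_n) × (z₁ K₁)` through the Jacquet datum of `ρ` (Casselman)

Cell `hodgecm-mathlib`, squad F0∕P3b → line LH6 (P3c), crux H413 = `stmt-HodgeConjecture-24833` (lane `--supports … --as helper`); seat LH5-p05 (g2), slice
(D-b) of LH6-p04 (g2)'s road (D) «DEEP-FL» (desk F0P3b-plan (g23) ruling 2026-09-02T04:10:49Z (3); interface `F0/P3b/LH6-p04/g2/ROAD-D.interface.txt`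
66a979a605f4c6ab §2).  THEOREMS ONLY, sorry-free, ★-only imports; no definition, no instance, no notation, no named fact; GENERIC (nothing here is
instantiated at `U(3)` or `H`).  Consumer: ★-to-be `F0P3cStCharTSCassHTrace.steinbergLabel_smoothTrace_shell_eq` (the slice on `H_v = U(Φ₂)(L⁺_v) × U(Φ₁)(L⁺_v)`).
HONEST LABEL: count-neutral; HC_CM is proved only modulo the 7 printed citations (2 remaining: hLiu418 = stmt-HodgeConjecture-24832, h413 =
stmt-HodgeConjecture-24833) until rung 0 closes.

* §1 group theory: `K_H (b, z) K_H = (K b K) ×ˢ (K₁ z K₁)` for `K_H = K × K₁`; `K z K = zK` for `z` commuting with `K`; dominance of `b = z·aᵐ` (`z` central, `m ≥ 1`)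
  at every Iwahori level from that of the ray `a`, in the binder shapes of ★ R2d [Casselman1995, Prop. 1.4.4]; subgroups of `GL₁` are commutative.
* §2 measure theory: `∫ 𝟙_{zK} χ dμ = μ(K) χ(z)` (`χ|_K = 1`, `μ` left-invariant); `μ(zK) = μ(K)`; `χ_ξ(𝟙_S) = μ(S) ξ(b)` for `ξ` constant on `S` (★ `charDist`);
  a character trivial on `K`, `K'` is constant on `K b K'`.
* §3 **`smoothTrace_boxChar_prodShell_eq`** — for an admissible `ρ` of `G` with finite-dimensional Jacquet module of `π_N`-trace `Σ_{θ ∈ s} θ` along a parabolic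
  triple with Iwahori datum, a character `χ` of `G₁`, a compact open `K₁ ≤ ker χ`: at every level `K_n` inside the ★ LEVEL-DEPTH neighbourhood and every dominant
  `b ∈ M`, `Tr (ρ ⊠ χ)(𝟙_{(K_n b K_n) × (z₁K₁)}) = μ(K_n)·#R·(μ₁(K₁)χ(z₁))·Σ_{θ ∈ s} θ(b)` (★ `smoothTrace_twist_comp_fst` + ★ R2d at `m = 1`)
  [Casselman1977, Thm. 5.2; Rogawski1990, §12.7 p. 193 «by Casselman's theorem χ_π(γ) = χ_{π_N}(γ)»].

## References
* [Casselman1977] W. Casselman, *Characters and Jacquet modules*, Math. Ann. 230 (1977) 101–105, Thm. 5.2.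
* [Casselman1995] W. Casselman, *Introduction to the theory of admissible representations of p-adic reductive groups* (draft 1995), Prop. 1.4.4, §3.3, §4.1.
* [BushnellHenniart2006] C. J. Bushnell, G. Henniart, *The Local Langlands Conjecture for GL(2)*, Grundlehren 335 (2006), §4.1, §9.1.
* [Rogawski1990] J. D. Rogawski, *Automorphic Representations of Unitary Groups in Three Variables*, Ann. of Math. Stud. 123 (1990): §12.7 p. 193; §13.1 Prop. 13.1.4 p. 199.
-/

set_option autoImplicit false
-- the mandated namespace has the single-problem summit's repeated segment (`HodgeConjecture.HodgeConjecture`)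
set_option linter.dupNamespace false

noncomputable section

open NumberField IsDedekindDomain MeasureTheory Topology
open scoped Matrix MatrixGroups Pointwise
open Literature.NumberTheory Literature.NumberTheory.Automorphic Literature.NumberTheory.Automorphic.UnitaryGroup
open Literature.NumberTheory.GaloisRepresentations
open Literature.NumberTheory.Rogawski1990

namespace Summit.HodgeConjecture.HodgeConjecture.Cruxes.H413.F0P3cStCharTSCassHTraceKit

/-! ## §1 Generic group theory: product shells, central double cosets, dominance of `z · aᵐ` -/

section Group

variable {G G₁ : Type*} [Group G] [Group G₁]

/-- A double coset of a product subgroup at a pair is the product of the double cosets. [cite: BushnellHenniart2006, §4.1] -/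
theorem doubleCoset_prod (K : Subgroup G) (K₁ : Subgroup G₁) (b : G) (z : G₁) :
    DoubleCoset.doubleCoset (b, z) ((K.prod K₁ : Subgroup (G × G₁)) : Set (G × G₁)) (K.prod K₁ : Subgroup (G × G₁)) =
      DoubleCoset.doubleCoset b (K : Set G) K ×ˢ DoubleCoset.doubleCoset z (K₁ : Set G₁) K₁ := by
  ext ⟨x, y⟩
  simp only [DoubleCoset.mem_doubleCoset, Set.mem_prod, SetLike.mem_coe, Subgroup.mem_prod, Prod.exists, Prod.mk_mul_mk,
    Prod.mk.injEq]
  constructor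
  · rintro ⟨k, k₁, ⟨hk, hk₁⟩, k', k₁', ⟨hk', hk₁'⟩, hx, hy⟩
    exact ⟨⟨k, hk, k', hk', hx⟩, ⟨k₁, hk₁, k₁', hk₁', hy⟩⟩
  · rintro ⟨⟨k, hk, k', hk', hx⟩, ⟨k₁, hk₁, k₁', hk₁', hy⟩⟩
    exact ⟨k, k₁, ⟨hk, hk₁⟩, k', k₁', ⟨hk', hk₁'⟩, hx, hy⟩

/-- A double coset `K z K` of an element commuting with `K` is the left coset `z K`. [cite: BushnellHenniart2006, §4.1] -/
theorem doubleCoset_eq_smul_of_forall_comm (K : Subgroup G) {z : G} (hz : ∀ k ∈ K, k * z = z * k) :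
    DoubleCoset.doubleCoset z (K : Set G) K = z • (K : Set G) := by
  ext x
  rw [DoubleCoset.mem_doubleCoset, Set.mem_smul_set]
  constructor
  · rintro ⟨k, hk, k', hk', rfl⟩
    exact ⟨k * k', K.mul_mem hk hk', by rw [smul_eq_mul, hz k hk, mul_assoc]⟩
  · rintro ⟨k, hk, rfl⟩
    exact ⟨1, K.one_mem, k, hk, by rw [one_mul, smul_eq_mul]⟩

/-- Iterated conjugation: if `a` conjugates `S ∩ N` into `S` and normalises `N`, then `aᵐ` conjugates `S ∩ N` into `S ∩ N`. [cite: Casselman1995, Prop. 1.4.4] -/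
theorem pow_mul_mul_pow_inv_mem {S N : Subgroup G} {a : G} (haN : ∀ x ∈ S ⊓ N, a * x * a⁻¹ ∈ S)
    (haNN : ∀ x ∈ N, a * x * a⁻¹ ∈ N) (m : ℕ) : ∀ x ∈ S ⊓ N, a ^ m * x * (a ^ m)⁻¹ ∈ S ⊓ N := by
  induction m with
  | zero => intro x hx; simpa using hx
  | succ m ih =>
    intro x hx
    have h1 := ih x hx
    have e : a ^ (m + 1) * x * (a ^ (m + 1))⁻¹ = a * (a ^ m * x * (a ^ m)⁻¹) * a⁻¹ := by
      rw [pow_succ']; group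
    rw [e]
    exact Subgroup.mem_inf.2 ⟨haN _ h1, haNN _ (Subgroup.mem_inf.1 h1).2⟩

/-- Iterated inverse conjugation: if `a⁻¹` conjugates `S ∩ N̄` into `S ∩ N̄`, then so does `(aᵐ)⁻¹`. [cite: Casselman1995, Prop. 1.4.4] -/
theorem pow_inv_mul_mul_pow_mem {S Nbar : Subgroup G} {a : G} (haNbar : ∀ x ∈ S ⊓ Nbar, a⁻¹ * x * a ∈ S ⊓ Nbar) (m : ℕ) :
    ∀ x ∈ S ⊓ Nbar, (a ^ m)⁻¹ * x * a ^ m ∈ S ⊓ Nbar := by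
  induction m with
  | zero => intro x hx; simpa using hx
  | succ m ih =>
    intro x hx
    have h1 := ih x hx
    have e : (a ^ (m + 1))⁻¹ * x * a ^ (m + 1) = a⁻¹ * ((a ^ m)⁻¹ * x * a ^ m) * a := by
      rw [pow_succ]; group
    rw [e]
    exact haNbar _ h1

variable [TopologicalSpace G]

/-- **Dominance of `b = z · aᵐ` (`z` central in `G` and in `M`, `m ≥ 1`) at every Iwahori level from that of the ray `a`**, in the binder shapes of ★ R2d
`Representation.smoothTrace_indicator_shell_eq`: `b ∈ M`, `b` commutes with `M`, `b (K_n ∩ N) b⁻¹ ⊆ K_n`, `b⁻¹ (K_n ∩ N̄) b ⊆ K_n ∩ N̄`, and the `b`-conjugates of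
every `x ∈ N` eventually lie in `K_n`. [cite: Casselman1995, Prop. 1.4.4, §4.1] -/
theorem dominant_central_mul_pow (t : ParabolicTriple G) (𝓘 : t.IwahoriDatum) {z : G} (hz : z ∈ Subgroup.center G) (hzM : z ∈ t.M)
    (haN : ∀ n, ∀ x ∈ 𝓘.K n ⊓ t.N, 𝓘.a * x * 𝓘.a⁻¹ ∈ 𝓘.K n)
    (haNbar : ∀ n, ∀ x ∈ 𝓘.K n ⊓ 𝓘.Nbar, 𝓘.a⁻¹ * x * 𝓘.a ∈ 𝓘.K n ⊓ 𝓘.Nbar)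
    (hexh : ∀ n, ∀ x ∈ t.N, ∃ m : ℕ, ∀ m', m ≤ m' → 𝓘.a ^ m' * x * (𝓘.a ^ m')⁻¹ ∈ 𝓘.K n) {m : ℕ} (hm : 1 ≤ m) :
    z * 𝓘.a ^ m ∈ t.M ∧ (∀ x ∈ t.M, x * (z * 𝓘.a ^ m) = z * 𝓘.a ^ m * x) ∧
      (∀ n, ∀ x ∈ 𝓘.K n ⊓ t.N, z * 𝓘.a ^ m * x * (z * 𝓘.a ^ m)⁻¹ ∈ 𝓘.K n) ∧
      (∀ n, ∀ x ∈ 𝓘.K n ⊓ 𝓘.Nbar, (z * 𝓘.a ^ m)⁻¹ * x * (z * 𝓘.a ^ m) ∈ 𝓘.K n ⊓ 𝓘.Nbar) ∧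
      (∀ n, ∀ x ∈ t.N, ∃ m₀ : ℕ, ∀ m', m₀ ≤ m' → (z * 𝓘.a ^ m) ^ m' * x * ((z * 𝓘.a ^ m) ^ m')⁻¹ ∈ 𝓘.K n) := by
  have hzc := Subgroup.mem_center_iff.1 hz
  -- `a` normalises `N` (`a ∈ M ≤ P ≤ N_G(N)`)
  have haNN : ∀ x ∈ t.N, 𝓘.a * x * 𝓘.a⁻¹ ∈ t.N := fun x hx =>
    (Subgroup.mem_normalizer_iff.1 (t.le_normalizer (t.M_le 𝓘.a_mem)) x).1 hx
  -- conjugation by `z · aᵐ` is conjugation by `aᵐ`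
  have hconj : ∀ x, z * 𝓘.a ^ m * x * (z * 𝓘.a ^ m)⁻¹ = 𝓘.a ^ m * x * (𝓘.a ^ m)⁻¹ := fun x => by
    calc z * 𝓘.a ^ m * x * (z * 𝓘.a ^ m)⁻¹ = z * (𝓘.a ^ m * x * (𝓘.a ^ m)⁻¹) * z⁻¹ := by group
      _ = 𝓘.a ^ m * x * (𝓘.a ^ m)⁻¹ := by rw [← hzc, mul_inv_cancel_right]
  have hconj' : ∀ x, (z * 𝓘.a ^ m)⁻¹ * x * (z * 𝓘.a ^ m) = (𝓘.a ^ m)⁻¹ * x * 𝓘.a ^ m := fun x => by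
    calc (z * 𝓘.a ^ m)⁻¹ * x * (z * 𝓘.a ^ m) = (𝓘.a ^ m)⁻¹ * (z⁻¹ * x * z) * 𝓘.a ^ m := by group
      _ = (𝓘.a ^ m)⁻¹ * x * 𝓘.a ^ m := by rw [mul_assoc z⁻¹, hzc x, inv_mul_cancel_left]
  refine ⟨t.M.mul_mem hzM (t.M.pow_mem 𝓘.a_mem m), fun x hx => ?_, fun n x hx => ?_, fun n x hx => ?_, fun n x hx => ?_⟩
  · have hxa : x * 𝓘.a ^ m = 𝓘.a ^ m * x := (Commute.pow_right (𝓘.a_comm x hx) m).eq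
    rw [← mul_assoc, hzc x, mul_assoc, hxa, ← mul_assoc]
  · rw [hconj]
    exact (Subgroup.mem_inf.1 (pow_mul_mul_pow_inv_mem (haN n) haNN m x hx)).1
  · rw [hconj']
    exact pow_inv_mul_mul_pow_mem (haNbar n) m x hx
  · obtain ⟨m₀, hm₀⟩ := hexh n x hx
    refine ⟨m₀, fun m' hm' => ?_⟩
    have hzam : Commute z (𝓘.a ^ m) := (hzc (𝓘.a ^ m)).symm
    rw [hzam.mul_pow, show (z ^ m' * (𝓘.a ^ m) ^ m') * x * (z ^ m' * (𝓘.a ^ m) ^ m')⁻¹ =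
      z ^ m' * ((𝓘.a ^ m) ^ m' * x * ((𝓘.a ^ m) ^ m')⁻¹) * (z ^ m')⁻¹ by group,
      ← Subgroup.mem_center_iff.1 (Subgroup.pow_mem _ hz m'), mul_inv_cancel_right, ← pow_mul]
    exact hm₀ (m * m') (le_trans hm' (Nat.le_mul_of_pos_left m' hm))

end Group

/-! ## §2 Generic measure theory: the `χ`-average of a coset indicator; `χ_ξ` of a shell indicator -/

section Measure

variable {G : Type*} [Group G] [MeasurableSpace G]

/-- **`∫ 𝟙_{zK}(u) χ(u) dμ = μ(K) · χ(z)`** for a left-invariant measure `μ`, a measurable subgroup `K` on which the character `χ` is trivial.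
[cite: BushnellHenniart2006, §4.1] -/
theorem integral_indicator_smul_mul_char [MeasurableMul G] (μ : Measure G) [μ.IsMulLeftInvariant] (K : Subgroup G)
    (hKm : MeasurableSet (K : Set G)) (χ : G →* ℂˣ) (hχ : ∀ k ∈ K, χ k = 1) (z : G) :
    ∫ u, (z • (K : Set G)).indicator (fun _ => (1 : ℂ)) u * ((χ u : ℂˣ) : ℂ) ∂μ = (μ.real (K : Set G) : ℂ) * ((χ z : ℂˣ) : ℂ) := by
  have hpt : ∀ u, (z • (K : Set G)).indicator (fun _ => (1 : ℂ)) u * ((χ u : ℂˣ) : ℂ) =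
      (z • (K : Set G)).indicator (fun _ => ((χ z : ℂˣ) : ℂ)) u := by
    intro u
    by_cases hu : u ∈ z • (K : Set G)
    · rw [Set.indicator_of_mem hu, Set.indicator_of_mem hu, one_mul]
      obtain ⟨k, hk, rfl⟩ := Set.mem_smul_set.1 hu
      rw [smul_eq_mul, map_mul, hχ k hk, mul_one]
    · rw [Set.indicator_of_notMem hu, Set.indicator_of_notMem hu, zero_mul]
  have hzK : z • (K : Set G) = (fun x => z⁻¹ * x) ⁻¹' (K : Set G) := by
    ext x; simp [Set.mem_smul_set_iff_inv_smul_mem]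
  have hmeas : MeasurableSet (z • (K : Set G)) := by
    rw [hzK]; exact hKm.preimage (measurable_const_mul z⁻¹)
  simp_rw [hpt]
  rw [integral_indicator_const _ hmeas, Complex.real_smul]
  congr 2
  simp only [measureReal_def, hzK, measure_preimage_mul]

/-- The left coset `zK` has the measure of `K` (left invariance). [cite: BushnellHenniart2006, §4.1] -/
theorem measure_smul_subgroup [MeasurableMul G] (μ : Measure G) [μ.IsMulLeftInvariant] (K : Subgroup G) (z : G) :
    μ (z • (K : Set G)) = μ (K : Set G) := by
  have hzK : z • (K : Set G) = (fun x => z⁻¹ * x) ⁻¹' (K : Set G) := by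
    ext x; simp [Set.mem_smul_set_iff_inv_smul_mem]
  rw [hzK, measure_preimage_mul]

/-- The same for the real-valued measure. [cite: BushnellHenniart2006, §4.1] -/
theorem measureReal_smul_subgroup [MeasurableMul G] (μ : Measure G) [μ.IsMulLeftInvariant] (K : Subgroup G) (z : G) :
    μ.real (z • (K : Set G)) = μ.real (K : Set G) := by
  simp only [measureReal_def, measure_smul_subgroup]

/-- **`χ_ξ(𝟙_S) = μ(S) · ξ(b)`** when the character `ξ` is constant `= ξ(b)` on the measurable set `S`. [cite: Rogawski1990, §13.1 Prop. 13.1.4 p. 199] -/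
theorem charDist_indicator_of_forall_eq (μ : Measure G) (ξ : G →* ℂˣ) {S : Set G} (hS : MeasurableSet S) {b : G}
    (h : ∀ x ∈ S, ξ x = ξ b) :
    charDist ξ μ (S.indicator fun _ => (1 : ℂ)) = (μ.real S : ℂ) * ((ξ b : ℂˣ) : ℂ) := by
  rw [charDist_def]
  have hpt : ∀ x, ((ξ x : ℂˣ) : ℂ) * S.indicator (fun _ => (1 : ℂ)) x = S.indicator (fun _ => ((ξ b : ℂˣ) : ℂ)) x := by
    intro x
    by_cases hx : x ∈ S
    · rw [Set.indicator_of_mem hx, Set.indicator_of_mem hx, mul_one, h x hx]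
    · rw [Set.indicator_of_notMem hx, Set.indicator_of_notMem hx, mul_zero]
  simp_rw [hpt]
  rw [integral_indicator_const _ hS, Complex.real_smul]

omit [MeasurableSpace G] in
/-- A character trivial on `K` and on `K'` is constant on the double coset `K b K'`. [cite: Rogawski1990, §13.1 Prop. 13.1.4 p. 199] -/
theorem apply_eq_of_mem_doubleCoset (ξ : G →* ℂˣ) {K K' : Subgroup G} (hK : ∀ k ∈ K, ξ k = 1) (hK' : ∀ k ∈ K', ξ k = 1) (b : G)
    {x : G} (hx : x ∈ DoubleCoset.doubleCoset b (K : Set G) K') : ξ x = ξ b := by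
  obtain ⟨k, hk, k', hk', rfl⟩ := DoubleCoset.mem_doubleCoset.1 hx
  rw [map_mul, map_mul, hK k hk, hK' k' hk', one_mul, mul_one]

end Measure

/-! ## §3 Generic: the character of `ρ ⊠ χ` on a product shell `(K_n b K_n) ×ˢ (z₁ K₁)` through the Jacquet datum of `ρ` (Casselman) -/

section BoxShell

universe u

variable {G G₁ : Type u} [Group G] [TopologicalSpace G] [NonarchimedeanGroup G] [Group G₁] [TopologicalSpace G₁] [NonarchimedeanGroup G₁]
  [LocallyCompactSpace G] [LocallyCompactSpace G₁] [T2Space G] [T2Space G₁] [SecondCountableTopology G] [SecondCountableTopology G₁]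
  [MeasurableSpace G] [BorelSpace G] [MeasurableSpace G₁] [BorelSpace G₁]
  {V : Type*} [AddCommGroup V] [Module ℂ V] {ρ : Representation ℂ G V}

/-- **`Tr (ρ ⊠ χ)(𝟙_{(K_n b K_n) × (z₁ K₁)}) = μ(K_n)·#R·(μ₁(K₁) χ(z₁))·Σ_{θ ∈ s} θ(b)` at every deep level** — generic Casselman step for an admissible `ρ` of `G`
with finite-dimensional Jacquet module of `π_N`-trace `Σ_s θ` along a parabolic triple `t` with Iwahori datum `𝓘`, a character `χ` of `G₁`, a compact open
`K₁ ≤ ker χ`, and a dominant `b ∈ M` (binder shapes of ★ R2d): ★ `smoothTrace_twist_comp_fst` (the `χ`-average of the product indicator is `μ₁(K₁)χ(z₁)·𝟙_{K_n b K_n}`),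
★ R2d `Representation.smoothTrace_indicator_shell_eq` at `m = 1`, ★ LEVEL-DEPTH `exists_nhds_forall_range_fixedPointsMk_eq_top` (`[V^{K_n}] = V_N` for `K_n ⊆ U`).
[cite: Casselman1977, Thm. 5.2] [cite: Casselman1995, §3.3, §4.1] [cite: BushnellHenniart2006, §9.1] -/
theorem smoothTrace_boxChar_prodShell_eq (hadm : ρ.IsAdmissible) (χ : G₁ →* ℂˣ)
    (μ : Measure G) [μ.IsMulLeftInvariant] [IsFiniteMeasureOnCompacts μ] [SigmaFinite μ]
    (μ₁ : Measure G₁) [μ₁.IsMulLeftInvariant] [IsFiniteMeasureOnCompacts μ₁] [SigmaFinite μ₁]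
    (t : ParabolicTriple G) (hN : IsClosed (t.N : Set G)) (𝓘 : t.IwahoriDatum) [FiniteDimensional ℂ (t.restrict ρ).Coinvariants]
    (s : Multiset (↥t.M →* ℂˣ)) (hs : ∀ m : ↥t.M, LinearMap.trace ℂ _ (ρ.jacquetModule t m) = (s.map fun θ : ↥t.M →* ℂˣ => ((θ m : ℂˣ) : ℂ)).sum) :
    ∃ U ∈ 𝓝 (1 : G), ∀ n : ℕ, ((𝓘.K n : Set G) ⊆ U) →
      ∀ (b : G) (hbM : b ∈ t.M), (∀ x ∈ t.M, x * b = b * x) → (∀ x ∈ 𝓘.K n ⊓ t.N, b * x * b⁻¹ ∈ 𝓘.K n) →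
        (∀ x ∈ 𝓘.K n ⊓ 𝓘.Nbar, b⁻¹ * x * b ∈ 𝓘.K n ⊓ 𝓘.Nbar) → (∀ x ∈ t.N, ∃ m₀ : ℕ, ∀ m', m₀ ≤ m' → b ^ m' * x * (b ^ m')⁻¹ ∈ 𝓘.K n) →
      ∀ (R : Finset G), IsLeftTransversal (𝓘.K n) (𝓘.K n ⊓ ConjAct.toConjAct b • 𝓘.K n) R →
      ∀ (K₁ : Subgroup G₁), IsOpen (K₁ : Set G₁) → IsCompact (K₁ : Set G₁) → (∀ k ∈ K₁, χ k = 1) → ∀ (z₁ : G₁),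
        (Representation.twist (ρ.comp (MonoidHom.fst G G₁)) (χ.comp (MonoidHom.snd G G₁))).smoothTrace (μ.prod μ₁)
            ((DoubleCoset.doubleCoset b (𝓘.K n : Set G) (𝓘.K n) ×ˢ (z₁ • (K₁ : Set G₁))).indicator fun _ => (1 : ℂ)) =
          (μ.real (𝓘.K n : Set G) : ℂ) * (R.card : ℂ) * ((μ₁.real (K₁ : Set G₁) : ℂ) * ((χ z₁ : ℂˣ) : ℂ)) *
            (s.map fun θ : ↥t.M →* ℂˣ => ((θ ⟨b, hbM⟩ : ℂˣ) : ℂ)).sum := by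
  obtain ⟨U, hU, hUr⟩ := Representation.exists_nhds_forall_range_fixedPointsMk_eq_top (ρ := ρ) t 𝓘 hadm
  refine ⟨U, hU, fun n hn b hbM hbcomm hbN hbNbar hbexh R hR K₁ hK₁o hK₁c hK₁χ z₁ => ?_⟩
  -- the two factors of the shell: compact open
  have hS₂o : IsOpen (DoubleCoset.doubleCoset b (𝓘.K n : Set G) (𝓘.K n)) := by
    unfold DoubleCoset.doubleCoset; exact (𝓘.isOpen_K n).mul_left
  have hS₂c : IsCompact (DoubleCoset.doubleCoset b (𝓘.K n : Set G) (𝓘.K n)) := ((𝓘.isCompact_K n).mul isCompact_singleton).mul (𝓘.isCompact_K n)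
  have hS₁o : IsOpen (z₁ • (K₁ : Set G₁)) := hK₁o.smul z₁
  have hS₁c : IsCompact (z₁ • (K₁ : Set G₁)) := hK₁c.smul z₁
  have hSc : IsCompact (DoubleCoset.doubleCoset b (𝓘.K n : Set G) (𝓘.K n) ×ˢ (z₁ • (K₁ : Set G₁))) := hS₂c.prod hS₁c
  have hf : IsLocSmooth ((DoubleCoset.doubleCoset b (𝓘.K n : Set G) (𝓘.K n) ×ˢ (z₁ • (K₁ : Set G₁))).indicator fun _ => (1 : ℂ)) :=
    isLocSmooth_indicator (hS₂o.prod hS₁o) hSc.isClosed hSc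
  have hf₂ : IsLocSmooth ((DoubleCoset.doubleCoset b (𝓘.K n : Set G) (𝓘.K n)).indicator fun _ => (1 : ℂ)) :=
    isLocSmooth_indicator hS₂o hS₂c.isClosed hS₂c
  -- `ker χ` is open (it contains the open `K₁`)
  have hχo : IsOpen ((χ.ker : Subgroup G₁) : Set G₁) :=
    Subgroup.isOpen_mono (H₁ := K₁) (fun k hk => by rw [MonoidHom.mem_ker]; exact hK₁χ k hk) hK₁o
  rw [smoothTrace_twist_comp_fst ρ χ hadm hχo μ μ₁ hf.1 hf.2]
  -- the `χ`-average of the product indicator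
  have havg : (fun g : G => ∫ u, ((DoubleCoset.doubleCoset b (𝓘.K n : Set G) (𝓘.K n) ×ˢ (z₁ • (K₁ : Set G₁))).indicator (fun _ => (1 : ℂ)) (g, u)) *
      ((χ u : ℂˣ) : ℂ) ∂μ₁) =
      ((μ₁.real (K₁ : Set G₁) : ℂ) * ((χ z₁ : ℂˣ) : ℂ)) • ((DoubleCoset.doubleCoset b (𝓘.K n : Set G) (𝓘.K n)).indicator fun _ => (1 : ℂ)) := by
    funext g
    have hpt : ∀ u : G₁, ((DoubleCoset.doubleCoset b (𝓘.K n : Set G) (𝓘.K n) ×ˢ (z₁ • (K₁ : Set G₁))).indicator (fun _ => (1 : ℂ)) (g, u)) *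
        ((χ u : ℂˣ) : ℂ) =
        ((DoubleCoset.doubleCoset b (𝓘.K n : Set G) (𝓘.K n)).indicator (fun _ => (1 : ℂ)) g) *
          ((z₁ • (K₁ : Set G₁)).indicator (fun _ => (1 : ℂ)) u * ((χ u : ℂˣ) : ℂ)) := by
      intro u
      rw [← mul_assoc]
      congr 1
      exact Set.indicator_prod_one
    simp_rw [hpt]
    rw [integral_const_mul, integral_indicator_smul_mul_char μ₁ K₁ hK₁o.measurableSet χ hK₁χ z₁, Pi.smul_apply, smul_eq_mul, mul_comm]
  rw [havg, ρ.smoothTrace_smul_of_mem μ hadm _ ⟨hf₂.1, hf₂.2⟩]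
  -- ★ R2d at `m = 1`, full Jacquet trace at the deep level
  have hR1 : IsLeftTransversal (𝓘.K n) (𝓘.K n ⊓ ConjAct.toConjAct (b ^ 1) • 𝓘.K n) R := by rwa [pow_one]
  have key := Representation.smoothTrace_indicator_shell_eq μ hadm t (𝓘.isOpen_K n) (𝓘.isCompact_K n) hN (𝓘.factorization n) hbM
    (fun k hk => hbcomm k (Subgroup.mem_inf.1 hk).2) hbN hbNbar hbexh le_rfl hR1
  rw [pow_one, pow_one] at key
  rw [key, LinearMap.trace_restrict_eq_of_forall_mem _ _ (fun x => Submodule.eq_top_iff'.1 (hUr n hn) _), hs ⟨b, hbM⟩]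
  ring

end BoxShell

end Summit.HodgeConjecture.HodgeConjecture.Cruxes.H413.F0P3cStCharTSCassHTraceKit

end
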